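import Literature.AnabelianGeometry.SemiGraphs.TemperedSpecialFibreAdmissibleKernel
import Literature.AnabelianGeometry.SemiGraphs.TemperedSpecialFibrePadicSchemaWitnesses
import Literature.AnabelianGeometry.SemiGraphs.TemperedPiChartExists
import Literature.AnabelianGeometry.SemiGraphs.WitnessIwahoriDouble
import HarnessLib

/-!
# [SemiAnbd] Cor. 3.11 and the steps (S1), (S2), (S3) of its printed proof: INSTANCE FORMS of the four
# frozen named facts `AdmissibleQuotientCompatible` (F-1724), `ResidueCharOfTemperedIso` (F-1725),
# `SpecialFibreIsoOfChartIso` (F-1727), `Cor311` (F-1721) at a named, inhabited class of carriers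

Mochizuki, *Semi-graphs of anabelioids*, Publ. RIMS **42** (2006), §3, Corollary 3.11 and its proof,
manuscript pp. 45–49 [cite: MochizukiSemiAnbd2006, Cor 3.11 pp.45-49]: "any isomorphism of topological
groups `γ : Δ[α] ⥲ Δ[β]` determines a compatible isomorphism of semi-graphs of anabelioids `G^c[α] ⥲ G^c[β]`
in a fashion that is functorial with respect to `γ`. Moreover, if such a `γ` exists, then `p_α = p_β`."

PROOF-ONLY file (0 definitions, no named fact) of the abc-iut cell, L-F sub-cell [SemiAnbd]+[CombGC], KEY
row INST59Ib2 (seat abc-iut-f-168 gen 9; FACT-LIST rows F-1724 / F-1725 / F-1727, trunk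
`TemperedSpecialFibreReductions.lean`, and F-1721, trunk `TemperedSpecialFibre.lean`).  The four named
facts are predicates on ORIGIN HYPOTHESES `Ω_□ : SpecialFibreOrigin K_□` (which certify "`S` IS the
special-fibre datum of the curve behind `D`") and their universal closures over the origin parameter are
REFUTED as typed (all-certifying junk origins: `not_forall_admissibleQuotientCompatible`,
`not_forall_residueCharOfTemperedIso`, abc-iut-w6-d077; `not_forall_specialFibreIsoOfChartIso`, the
cusp-omission pair, abc-iut-f-177; `not_forall_cor311`); so an INSTANCE FORM of such a row is the row
itself at a NAMED origin — stated here with the origin written inline (`let Ω := …`, no new definition).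

THE CARRIER CLASS `𝒞` (certified by the origin `Ω_𝒞` over `ℚ_p` of §2–§5): special-fibre data `(D, S)`
whose admissible quotient `Δ ↠ π₁^temp(G^c)` is INJECTIVE, with `G^c` FINITE and NODES ONLY (every edge
closed).  It is inhabited, for every prime `p`, by the split `p`-adic models `Π := π₁^temp(𝒢) × G_{ℚ_p}`
(`Δ = π₁^temp(𝒢) × 1`, admissible quotient `pr₁|_Δ`; the shape of abc-iut-w5's
`TemperedArithmeticGroup.exists_padic_specialFibreModel`, re-proved in §1 with the injectivity exposed) over
the genuine finite graphs of anabelioids of the Iwahori witness family — `𝒢₁(p)` (`IwahoriWitness.loopGraph`: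
one vertex `ℤ_p ⋊ (1 + pℤ_p)`, one NODE) and `𝒟₁(p)` (`IwahoriWitness.doubleLoop`: two vertices, one node) —
with their tempered charts (`ExistsTemperedPiChart_holds`, Prop. 3.6 (i)(ii) proved): §6.

1. **F-1724 (S1)** `AdmissibleQuotientCompatible Ω_𝒞 Ω_𝒞` — for EVERY `γ : Δ[α] ⥲ Δ[β]` between certified
   carriers: the kernel `⊥` of an injective admissible quotient is `γ`-stable, and the DESCENT of `γ` to an
   isomorphism of TOPOLOGICAL groups `π₁^temp(G^c[α]) ⥲ π₁^temp(G^c[β])` is abc-iut-w4's kernel-checked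
   `SpecialFibreData.descend` (open mapping theorem for the admissible quotients).
2. **F-1727 (S3)** `SpecialFibreIsoOfChartIso Ω Ω'` at the WIDER class «finite, nodes only» (no injectivity),
   for EVERY `φ` and any two base fields: Cor. 3.9 in isomorphism form at the finite graphs `G[□]`
   (abc-iut-w4-d083 `SpecialFibreData.exists_isIso_graphCompatible_of_finite`, a kernel theorem), the
   extension along the cusps at the EMPTY cusp matching (`exists_cuspExtension_of_cuspMatching`), and the
   proved uniqueness `chartCompatible_base_maps_unique` — assembled by `specialFibreIso_of_cuspExtensionIso_of_finite`.
3. **F-1725 (S2)** `ResidueCharOfTemperedIso p p Ωα Ωβ` — the DIAGONAL instance, for ALL origins over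
   finite extensions of one `ℚ_p` (conclusion `p = p`).  HONEST LABEL: the off-diagonal content of (S2)
   («`Δ` determines `p`») needs a carrier whose geometric tempered group is tied to the residue
   characteristic — print's inertia sentences (S2a)/(S2b) p. 48 (`InertiaOrdersPrimePow`,
   `HasNontrivialInertia`, abc-iut-L3-t11); NO carrier in the tree links `Δ` to `p` (the `p`-adic models are
   split products over an arbitrary graph), so that instance is open-SIZED, not claimed.  §4 adds the
   CONTRAST at `(2, 3)`: origins certifying nodes-only carriers with ONE resp. TWO vertices satisfy
   `ResidueCharOfTemperedIso 2 3` — `Δ[α] ≅ Δ[β]` would force equally many vertices by Cor. 3.9 (kernel) — where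
   the all-certifying origins refute it (`not_residueCharOfTemperedIso_of_allCertifying`); a synthetic tie
   (vertex count by fiat), recorded as such.
4. **F-1721** `Cor311 p p Ω_𝒞 Ω_𝒞` — by the tree's `corollary_3_11_of_steps` from 1–3: «every `γ : Δ[α] ⥲ Δ[β]`
   between certified carriers determines a `γ`-compatible isomorphism `G^c[α] ⥲ G^c[β]`, unique on underlying
   semi-graphs, and `p = p`».

HONEST LABEL for all four: INSTANCE-PROVED at the named carrier class; DEGENERATE aspects — split extension
(trivial outer Galois action), `Δ ≅ π₁^temp(G^c)`, no cusps (print's (i)–(iv) p. 47 idle), diagonal residue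
characteristic; the carriers are NOT asserted to be stable-model special fibres; ∀-closures REFUTED-as-typed
UNCHANGED.  An instance form of OUR typed statement is not a theorem about [SemiAnbd] Cor. 3.11 in print
(Mochizuki's theorem about actual curves, whose origin certificate the tree cannot construct); nothing here
takes a side on [IUTchIII] Cor. 3.12 or asserts that abc is proved or refuted; typed ≠ proved.
-/

open CategoryTheory Topology

noncomputable section

namespace Literature.AnabelianGeometry.SemiGraphs

open ProfiniteSemiGraph
open Literature.AlgebraicGeometry.Frobenioids (IsSlimGroup)

universe u

/-! ### §1 The carriers: split `p`-adic models with INJECTIVE admissible quotient over a finite graph -/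

/-- **Split `p`-adic model with injective admissible quotient.**  For a semi-graph of anabelioids `𝒢`
satisfying the hypotheses of Thm. 3.7 with a tempered chart `c`: `Π := π₁^temp(𝒢) × G_{ℚ_p}` with augmentation
`pr₂`, `Δ = π₁^temp(𝒢) × 1`, special fibre `(𝒢, c)` with admissible quotient `pr₁|_Δ` — which is INJECTIVE.
Verbatim the construction of `TemperedArithmeticGroup.exists_padic_specialFibreModel` (abc-iut-w5), with the
injectivity and the graph recorded in the conclusion.  DEGENERATE (split; `𝒢` is not asserted to be a
stable-model special fibre). [cite: MochizukiSemiAnbd2006, Ex 3.10 pp.43-45] -/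
theorem TemperedArithmeticGroup.exists_padic_specialFibreModel_injective (p : ℕ) [Fact p.Prime]
    (𝒢 : ProfiniteSemiGraph.{0}) (h37 : 𝒢.Thm37Hypotheses) (c : ProfiniteSemiGraph.TemperedPiChart 𝒢) :
    ∃ (D : TemperedArithmeticGroup ℚ_[p]) (S : SpecialFibreData D),
      S.Gc = 𝒢 ∧ Function.Injective S.admissible := by
  classical
  haveI : IsGalois ℚ_[p] (AlgebraicClosure ℚ_[p]) := {}
  haveI : CompactSpace (Field.absoluteGaloisGroup ℚ_[p]) := by
    change CompactSpace (AlgebraicClosure ℚ_[p] ≃ₐ[ℚ_[p]] AlgebraicClosure ℚ_[p]); infer_instance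
  haveI : T2Space (Field.absoluteGaloisGroup ℚ_[p]) := krullTopology_t2
  haveI : TotallyDisconnectedSpace (Field.absoluteGaloisGroup ℚ_[p]) := by
    change TotallyDisconnectedSpace (AlgebraicClosure ℚ_[p] ≃ₐ[ℚ_[p]] AlgebraicClosure ℚ_[p])
    infer_instance
  haveI : SecondCountableTopology (Field.absoluteGaloisGroup ℚ_[p]) :=
    secondCountableTopology_absoluteGaloisGroup_padic p
  have hSlimG : IsSlimGroup (Field.absoluteGaloisGroup ℚ_[p]) :=
    Literature.AnabelianGeometry.AbsoluteAnabelian.galoisMLF_slim_holds p ℚ_[p]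
  haveI : SecondCountableTopology c.G := c.secondCountableTopology
  have hSlimC : IsSlimGroup c.G := ProfiniteSemiGraph.temperedPiSlim_holds 𝒢 h37.toProp36Hypotheses c
  let aug : (c.G × Field.absoluteGaloisGroup ℚ_[p]) →ₜ* Field.absoluteGaloisGroup ℚ_[p] :=
    ContinuousMonoidHom.snd _ _
  have haug_mem : ∀ x : c.G × Field.absoluteGaloisGroup ℚ_[p], x ∈ aug.toMonoidHom.ker ↔ x.2 = 1 :=
    fun x => MonoidHom.mem_ker
  have hkerClosed : IsClosed (aug.toMonoidHom.ker : Set (c.G × Field.absoluteGaloisGroup ℚ_[p])) := by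
    rw [MonoidHom.coe_ker]; exact isClosed_singleton.preimage (map_continuous aug)
  let eKer : c.G ≃ₜ* aug.toMonoidHom.ker :=
    { toFun := fun γ => ⟨(γ, 1), (haug_mem _).mpr rfl⟩
      invFun := fun x => x.1.1
      left_inv := fun _ => rfl
      right_inv := fun x => by
        obtain ⟨⟨γ, g⟩, hx⟩ := x
        have hg : g = 1 := (haug_mem _).mp hx
        subst hg; rfl
      map_mul' := fun _ _ => rfl
      continuous_toFun := (continuous_id.prodMk continuous_const).subtype_mk _
      continuous_invFun := continuous_fst.comp continuous_subtype_val }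
  have hT : IsTempered (c.G × Field.absoluteGaloisGroup ℚ_[p]) := c.isTempered.prod_of_profinite
  let D : TemperedArithmeticGroup ℚ_[p] :=
    { Pi := c.G × Field.absoluteGaloisGroup ℚ_[p]
      isTempered := hT
      aug := aug
      aug_surjective := fun g => ⟨(1, g), rfl⟩
      isTempered_ker := hT.subgroup_of_isClosed _ hkerClosed
      isSlimGroup := isSlimGroup_prod hSlimC hSlimG
      isSlimGroup_ker := isSlimGroup_of_continuousMulEquiv eKer hSlimC
      secondCountableTopology := inferInstance }
  let adm : D.delta →ₜ* c.G :=
    ⟨(MonoidHom.fst c.G (Field.absoluteGaloisGroup ℚ_[p])).comp D.delta.subtype,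
      continuous_fst.comp continuous_subtype_val⟩
  let S : SpecialFibreData D :=
    { Gc := 𝒢, hyp := h37, chart := c, admissible := adm,
      admissible_surjective := fun g => ⟨⟨(g, 1), (haug_mem _).mpr rfl⟩, rfl⟩ }
  refine ⟨D, S, rfl, fun x y hxy => ?_⟩
  have hx : x.1.2 = 1 := (haug_mem _).mp x.2
  have hy : y.1.2 = 1 := (haug_mem _).mp y.2
  exact Subtype.ext (Prod.ext hxy (hx.trans hy.symm))

namespace SpecialFibreData

variable {Kα : Type u} [Field Kα] {Kβ : Type u} [Field Kβ]
  {Dα : TemperedArithmeticGroup Kα} {Dβ : TemperedArithmeticGroup Kβ}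
  (Sα : SpecialFibreData Dα) (Sβ : SpecialFibreData Dβ)

/-- When both admissible quotients are injective, EVERY `γ : Δ[α] ⥲ Δ[β]` is kernel-compatible
(`γ(⊥) = ⊥`). [cite: MochizukiSemiAnbd2006, Cor 3.11 pp.48-49] -/
theorem kernelCompatible_of_injective (hα : Function.Injective Sα.admissible)
    (hβ : Function.Injective Sβ.admissible) (γ : Dα.delta ≃ₜ* Dβ.delta) : Sα.KernelCompatible Sβ γ := by
  intro x
  constructor
  · intro hx
    have h1 : x = 1 := hα (by rw [hx, map_one])
    rw [h1, map_one, map_one]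
  · intro hx
    have h1 : γ x = 1 := hβ (by rw [hx, map_one])
    have h2 : x = 1 := γ.injective (by rw [h1, map_one])
    rw [h2, map_one]

/-- When every edge of both special fibres is a NODE (no cusps), every `F₀ : G[α] → G[β]` matches the cusps
— the cusp matching is the empty one. [cite: MochizukiSemiAnbd2006, Cor 3.11 pp.46-47] -/
theorem cuspMatching_of_forall_isClosedEdge (hα : ∀ e, Sα.Gc.graph.IsClosedEdge e)
    (hβ : ∀ e, Sβ.Gc.graph.IsClosedEdge e) (F₀ : Hom Sα.graph Sβ.graph) : Sα.CuspMatching Sβ F₀ := by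
  haveI : IsEmpty {e : Sα.Gc.graph.Edge // ¬ Sα.Gc.graph.IsClosedEdge e} := ⟨fun x => x.2 (hα x.1)⟩
  haveI : IsEmpty {e : Sβ.Gc.graph.Edge // ¬ Sβ.Gc.graph.IsClosedEdge e} := ⟨fun x => x.2 (hβ x.1)⟩
  exact ⟨Equiv.equivOfIsEmpty _ _, fun x => (x.2 (hα x.1)).elim⟩

/-- **(S3) at a FINITE, NODES-ONLY pair, for every `φ`**: Cor. 3.9 in isomorphism form at the finite graphs
`G[□] = G^c[□]` (`exists_isIso_graphCompatible_of_finite`), the extension along the (absent) cusps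
(`exists_cuspExtension_of_cuspMatching` at the empty matching) and the uniqueness
`chartCompatible_base_maps_unique`. [cite: MochizukiSemiAnbd2006, Cor 3.11 pp.46-48] -/
theorem specialFibreIsoOfChartIso_conclusion_of_finite_nodesOnly [Finite Sα.Gc.graph.Vertex]
    [Finite Sα.Gc.graph.Edge] [Finite Sβ.Gc.graph.Vertex] [Finite Sβ.Gc.graph.Edge]
    (hα : ∀ e, Sα.Gc.graph.IsClosedEdge e) (hβ : ∀ e, Sβ.Gc.graph.IsClosedEdge e)
    (φ : Sα.chart.G ≃ₜ* Sβ.chart.G) :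
    ∃ F : Hom Sα.Gc Sβ.Gc, F.IsIso ∧ Sα.ChartCompatible Sβ φ F ∧
      ∀ F' : Hom Sα.Gc Sβ.Gc, F'.IsIso → Sα.ChartCompatible Sβ φ F' →
        F'.base.vertexMap = F.base.vertexMap ∧ F'.base.edgeMap = F.base.edgeMap :=
  Sα.specialFibreIso_of_cuspExtensionIso_of_finite Sβ φ fun F₀ hF₀ hc =>
    Sα.exists_cuspExtension_of_cuspMatching Sβ φ F₀ hF₀ hc
      (Sα.cuspMatching_of_forall_isClosedEdge Sβ hα hβ F₀)

/-- **Isomorphic geometric tempered groups of carriers with injective admissible quotients have special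
fibres with equally many vertices** (finite case): `γ` descends (`descend`) and Cor. 3.9 in isomorphism form
(`exists_isIso_graphCompatible_of_finite`) gives a bijection on the vertices of `G[□]`, i.e. of `G^c[□]`.
[cite: MochizukiSemiAnbd2006, Cor 3.11 p.46] -/
theorem natCard_vertex_eq_of_injective_of_finite [Finite Sα.Gc.graph.Vertex] [Finite Sα.Gc.graph.Edge]
    [Finite Sβ.Gc.graph.Vertex] [Finite Sβ.Gc.graph.Edge] (hα : Function.Injective Sα.admissible)
    (hβ : Function.Injective Sβ.admissible) (γ : Dα.delta ≃ₜ* Dβ.delta) :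
    Nat.card Sα.Gc.graph.Vertex = Nat.card Sβ.Gc.graph.Vertex := by
  obtain ⟨F₀, hF₀, -⟩ := Sα.exists_isIso_graphCompatible_of_finite Sβ
    (Sα.descend Sβ γ (Sα.kernelCompatible_of_injective Sβ hα hβ γ))
  have eα : Sα.graph.graph.Vertex ≃ Sα.Gc.graph.Vertex := Equiv.Set.univ _
  have eβ : Sβ.graph.graph.Vertex ≃ Sβ.Gc.graph.Vertex := Equiv.Set.univ _
  rw [← Nat.card_congr eα, ← Nat.card_congr eβ]
  exact Nat.card_congr (Equiv.ofBijective _ hF₀.bijective_vertexMap)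

end SpecialFibreData

/-! ### §2 F-1724 (S1) `AdmissibleQuotientCompatible` -/

section Instances

variable {Kα : Type u} [Field Kα] {Kβ : Type u} [Field Kβ]

/-- **(S1) at origins certifying only carriers with INJECTIVE admissible quotient**, for every `γ`: kernel
compatibility is automatic and the descent is the tree's construction
(`admissibleQuotientCompatible_of_admissibleKernelCompatible`). [cite: MochizukiSemiAnbd2006, Cor 3.11 pp.48-49] -/
theorem admissibleQuotientCompatible_of_certifies_injective (Ωα : SpecialFibreOrigin Kα)
    (Ωβ : SpecialFibreOrigin Kβ)
    (hα : ∀ D S, Ωα.IsSpecialFibreOf D S → Function.Injective S.admissible)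
    (hβ : ∀ D S, Ωβ.IsSpecialFibreOf D S → Function.Injective S.admissible) :
    AdmissibleQuotientCompatible Ωα Ωβ :=
  admissibleQuotientCompatible_of_admissibleKernelCompatible fun Dα Dβ Sα Sβ cα cβ γ =>
    Sα.kernelCompatible_of_injective Sβ (hα Dα Sα cα) (hβ Dβ Sβ cβ) γ

/-- **F-1724, INSTANCE FORM** (head = the frozen declaration, no `Prop` hypothesis): at the origin `Ω_𝒞`
over `ℚ_p` certifying exactly the class `𝒞` (injective admissible quotient, finite nodes-only special fibre;
inhabited, §6), (S1) `AdmissibleQuotientCompatible Ω_𝒞 Ω_𝒞` HOLDS — for every `γ`.  INSTANCE-PROVED at a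
named DEGENERATE carrier class; the ∀-closure stays REFUTED as typed (`not_forall_admissibleQuotientCompatible`).
[cite: MochizukiSemiAnbd2006, Cor 3.11 pp.46-48] -/
theorem admissibleQuotientCompatible_instance_injectiveNodesOnly (p : ℕ) [Fact p.Prime] :
    let Ω : SpecialFibreOrigin ℚ_[p] :=
      { IsOfGeometricOrigin := fun D => ∃ S : SpecialFibreData D, Function.Injective S.admissible ∧
          Finite S.Gc.graph.Vertex ∧ Finite S.Gc.graph.Edge ∧ ∀ e, S.Gc.graph.IsClosedEdge e
        IsTateOrigin := fun _ => False
        isOfGeometricOrigin_of_isTateOrigin := fun _ h => h.elim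
        IsSpecialFibreOf := fun _ S => Function.Injective S.admissible ∧
          Finite S.Gc.graph.Vertex ∧ Finite S.Gc.graph.Edge ∧ ∀ e, S.Gc.graph.IsClosedEdge e
        isOfGeometricOrigin_of_isSpecialFibreOf := fun _ S h => ⟨S, h⟩ }
    Literature.AnabelianGeometry.SemiGraphs.AdmissibleQuotientCompatible Ω Ω :=
  admissibleQuotientCompatible_of_certifies_injective _ _ (fun _ _ h => h.1) (fun _ _ h => h.1)

/-! ### §3 F-1727 (S3) `SpecialFibreIsoOfChartIso` -/

/-- **(S3) at origins certifying only FINITE, NODES-ONLY special fibres**, for every `φ` and any two base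
fields (Cor. 3.9 iso form at finite graphs + the empty cusp extension + uniqueness, all kernel theorems).
[cite: MochizukiSemiAnbd2006, Cor 3.11 pp.46-48] -/
theorem specialFibreIsoOfChartIso_of_certifies_finite_nodesOnly (Ωα : SpecialFibreOrigin Kα)
    (Ωβ : SpecialFibreOrigin Kβ)
    (hα : ∀ D S, Ωα.IsSpecialFibreOf D S →
      Finite S.Gc.graph.Vertex ∧ Finite S.Gc.graph.Edge ∧ ∀ e, S.Gc.graph.IsClosedEdge e)
    (hβ : ∀ D S, Ωβ.IsSpecialFibreOf D S →
      Finite S.Gc.graph.Vertex ∧ Finite S.Gc.graph.Edge ∧ ∀ e, S.Gc.graph.IsClosedEdge e) :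
    SpecialFibreIsoOfChartIso Ωα Ωβ := by
  intro Dα Dβ Sα Sβ cα cβ φ
  obtain ⟨hVα, hEα, hnα⟩ := hα Dα Sα cα
  obtain ⟨hVβ, hEβ, hnβ⟩ := hβ Dβ Sβ cβ
  exact Sα.specialFibreIsoOfChartIso_conclusion_of_finite_nodesOnly Sβ hnα hnβ φ

/-- **F-1727, INSTANCE FORM** (head = the frozen declaration, no `Prop` hypothesis): at the origin `Ω_𝒞` over
`ℚ_p` (§2; inhabited, §6) (S3) `SpecialFibreIsoOfChartIso Ω_𝒞 Ω_𝒞` HOLDS — every isomorphism `φ` of the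
tempered fundamental groups of two certified special fibres comes from an isomorphism of the semi-graphs of
anabelioids compatible with it, unique on underlying semi-graphs.  INSTANCE-PROVED at a named carrier class
(genuine NODES, no cusps); the ∀-closure stays REFUTED as typed (`not_forall_specialFibreIsoOfChartIso`, the
cusp-omission pair — excluded from `𝒞` by «nodes only»). [cite: MochizukiSemiAnbd2006, Cor 3.11 pp.46-49] -/
theorem specialFibreIsoOfChartIso_instance_injectiveNodesOnly (p : ℕ) [Fact p.Prime] :
    let Ω : SpecialFibreOrigin ℚ_[p] :=
      { IsOfGeometricOrigin := fun D => ∃ S : SpecialFibreData D, Function.Injective S.admissible ∧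
          Finite S.Gc.graph.Vertex ∧ Finite S.Gc.graph.Edge ∧ ∀ e, S.Gc.graph.IsClosedEdge e
        IsTateOrigin := fun _ => False
        isOfGeometricOrigin_of_isTateOrigin := fun _ h => h.elim
        IsSpecialFibreOf := fun _ S => Function.Injective S.admissible ∧
          Finite S.Gc.graph.Vertex ∧ Finite S.Gc.graph.Edge ∧ ∀ e, S.Gc.graph.IsClosedEdge e
        isOfGeometricOrigin_of_isSpecialFibreOf := fun _ S h => ⟨S, h⟩ }
    Literature.AnabelianGeometry.SemiGraphs.SpecialFibreIsoOfChartIso Ω Ω :=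
  specialFibreIsoOfChartIso_of_certifies_finite_nodesOnly _ _ (fun _ _ h => h.2) (fun _ _ h => h.2)

/-! ### §4 F-1725 (S2) `ResidueCharOfTemperedIso` -/

/-- **(S2), the DIAGONAL instance, for ALL origins**: over finite extensions of one `ℚ_p` the typed conclusion
`p = p` holds outright.  DEGENERATE by construction (the off-diagonal content — `Δ` determines `p`, print's
inertia argument p. 48 — is not exercised). [cite: MochizukiSemiAnbd2006, Cor 3.11 p.48] -/
theorem residueCharOfTemperedIso_diagonal (p : ℕ) [Fact p.Prime] [Algebra ℚ_[p] Kα]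
    [FiniteDimensional ℚ_[p] Kα] [Algebra ℚ_[p] Kβ] [FiniteDimensional ℚ_[p] Kβ]
    (Ωα : SpecialFibreOrigin Kα) (Ωβ : SpecialFibreOrigin Kβ) : ResidueCharOfTemperedIso p p Ωα Ωβ :=
  fun _ _ _ _ _ _ _ => rfl

/-- **F-1725, INSTANCE FORM** (head = the frozen declaration, no `Prop` hypothesis): at the origin `Ω_𝒞` over
`ℚ_p` (§2; inhabited, §6), `ResidueCharOfTemperedIso p p Ω_𝒞 Ω_𝒞` — the DIAGONAL instance (label: DEGENERATE;
the ∀-closure stays REFUTED as typed, `not_forall_residueCharOfTemperedIso`, at `(2, 3)`).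
[cite: MochizukiSemiAnbd2006, Cor 3.11 p.48] -/
theorem residueCharOfTemperedIso_instance_injectiveNodesOnly (p : ℕ) [Fact p.Prime] :
    let Ω : SpecialFibreOrigin ℚ_[p] :=
      { IsOfGeometricOrigin := fun D => ∃ S : SpecialFibreData D, Function.Injective S.admissible ∧
          Finite S.Gc.graph.Vertex ∧ Finite S.Gc.graph.Edge ∧ ∀ e, S.Gc.graph.IsClosedEdge e
        IsTateOrigin := fun _ => False
        isOfGeometricOrigin_of_isTateOrigin := fun _ h => h.elim
        IsSpecialFibreOf := fun _ S => Function.Injective S.admissible ∧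
          Finite S.Gc.graph.Vertex ∧ Finite S.Gc.graph.Edge ∧ ∀ e, S.Gc.graph.IsClosedEdge e
        isOfGeometricOrigin_of_isSpecialFibreOf := fun _ S h => ⟨S, h⟩ }
    Literature.AnabelianGeometry.SemiGraphs.ResidueCharOfTemperedIso p p Ω Ω :=
  residueCharOfTemperedIso_diagonal p _ _

/-- **(S2) OFF the diagonal, CONTRAST at `(2, 3)`**: at origins over `ℚ_2` resp. `ℚ_3` certifying carriers of
`𝒞` with ONE resp. TWO vertices, `ResidueCharOfTemperedIso 2 3` HOLDS — an isomorphism `Δ[α] ≅ Δ[β]` would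
force equally many vertices (`natCard_vertex_eq_of_injective_of_finite`, Cor. 3.9), so no such `γ` exists —
whereas at the all-certifying origins it FAILS (`not_residueCharOfTemperedIso_of_allCertifying`).  SYNTHETIC
tie of the residue characteristic to the carrier (vertex count by fiat; both origins inhabited, §6: `𝒢₁(q)`
has one vertex, `𝒟₁(q)` two); print's inertia mechanism is NOT exercised. [cite: MochizukiSemiAnbd2006, Cor 3.11 p.48] -/
theorem residueCharOfTemperedIso_two_three_vertexCount :
    let Ωα : SpecialFibreOrigin ℚ_[2] :=
      { IsOfGeometricOrigin := fun _ => True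
        IsTateOrigin := fun _ => False
        isOfGeometricOrigin_of_isTateOrigin := fun _ _ => trivial
        IsSpecialFibreOf := fun _ S => Function.Injective S.admissible ∧
          Finite S.Gc.graph.Vertex ∧ Finite S.Gc.graph.Edge ∧ Nat.card S.Gc.graph.Vertex = 1
        isOfGeometricOrigin_of_isSpecialFibreOf := fun _ _ _ => trivial }
    let Ωβ : SpecialFibreOrigin ℚ_[3] :=
      { IsOfGeometricOrigin := fun _ => True
        IsTateOrigin := fun _ => False
        isOfGeometricOrigin_of_isTateOrigin := fun _ _ => trivial
        IsSpecialFibreOf := fun _ S => Function.Injective S.admissible ∧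
          Finite S.Gc.graph.Vertex ∧ Finite S.Gc.graph.Edge ∧ Nat.card S.Gc.graph.Vertex = 2
        isOfGeometricOrigin_of_isSpecialFibreOf := fun _ _ _ => trivial }
    Literature.AnabelianGeometry.SemiGraphs.ResidueCharOfTemperedIso 2 3 Ωα Ωβ := by
  rintro Ωα Ωβ Dα Dβ Sα Sβ ⟨hiα, hVα, hEα, h1⟩ ⟨hiβ, hVβ, hEβ, h2⟩ ⟨γ⟩
  have h := Sα.natCard_vertex_eq_of_injective_of_finite Sβ hiα hiβ γ
  omega

/-! ### §5 F-1721 `Cor311` -/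

/-- **Cor. 3.11 (diagonal residue characteristic) at origins certifying only carriers of the class `𝒞`**,
for every `γ`: `corollary_3_11_of_steps` from (S1) `admissibleQuotientCompatible_of_certifies_injective`, (S2)
`residueCharOfTemperedIso_diagonal`, (S3) `specialFibreIsoOfChartIso_of_certifies_finite_nodesOnly`.
[cite: MochizukiSemiAnbd2006, Cor 3.11 pp.45-49] -/
theorem cor311_of_certifies_injective_finite_nodesOnly (p : ℕ) [Fact p.Prime] [Algebra ℚ_[p] Kα]
    [FiniteDimensional ℚ_[p] Kα] [Algebra ℚ_[p] Kβ] [FiniteDimensional ℚ_[p] Kβ]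
    (Ωα : SpecialFibreOrigin Kα) (Ωβ : SpecialFibreOrigin Kβ)
    (hα : ∀ D S, Ωα.IsSpecialFibreOf D S → Function.Injective S.admissible ∧
      Finite S.Gc.graph.Vertex ∧ Finite S.Gc.graph.Edge ∧ ∀ e, S.Gc.graph.IsClosedEdge e)
    (hβ : ∀ D S, Ωβ.IsSpecialFibreOf D S → Function.Injective S.admissible ∧
      Finite S.Gc.graph.Vertex ∧ Finite S.Gc.graph.Edge ∧ ∀ e, S.Gc.graph.IsClosedEdge e) :
    Cor311 p p Ωα Ωβ :=
  corollary_3_11_of_steps p p Ωα Ωβ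
    (admissibleQuotientCompatible_of_certifies_injective Ωα Ωβ (fun D S h => (hα D S h).1)
      (fun D S h => (hβ D S h).1))
    (residueCharOfTemperedIso_diagonal p Ωα Ωβ)
    (specialFibreIsoOfChartIso_of_certifies_finite_nodesOnly Ωα Ωβ (fun D S h => (hα D S h).2)
      (fun D S h => (hβ D S h).2))

/-- **F-1721, INSTANCE FORM** (head = the frozen declaration, no `Prop` hypothesis): at the origin `Ω_𝒞` over
`ℚ_p` (§2; inhabited with genuine nodes, §6), `Cor311 p p Ω_𝒞 Ω_𝒞` HOLDS: every isomorphism `γ : Δ[α] ⥲ Δ[β]`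
of topological groups between certified carriers determines a `γ`-compatible isomorphism `G^c[α] ⥲ G^c[β]` of
the special-fibre semi-graphs of anabelioids, unique on underlying semi-graphs; and `p = p`.  INSTANCE-PROVED
at a named DEGENERATE carrier class (split, `Δ ≅ π₁^temp(G^c)`, no cusps, diagonal); the ∀-closure stays
REFUTED as typed (`not_forall_cor311`); NOT «Cor. 3.11 proved as printed».
[cite: MochizukiSemiAnbd2006, Cor 3.11 pp.45-49] -/
theorem cor311_instance_injectiveNodesOnly (p : ℕ) [Fact p.Prime] :
    let Ω : SpecialFibreOrigin ℚ_[p] :=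
      { IsOfGeometricOrigin := fun D => ∃ S : SpecialFibreData D, Function.Injective S.admissible ∧
          Finite S.Gc.graph.Vertex ∧ Finite S.Gc.graph.Edge ∧ ∀ e, S.Gc.graph.IsClosedEdge e
        IsTateOrigin := fun _ => False
        isOfGeometricOrigin_of_isTateOrigin := fun _ h => h.elim
        IsSpecialFibreOf := fun _ S => Function.Injective S.admissible ∧
          Finite S.Gc.graph.Vertex ∧ Finite S.Gc.graph.Edge ∧ ∀ e, S.Gc.graph.IsClosedEdge e
        isOfGeometricOrigin_of_isSpecialFibreOf := fun _ S h => ⟨S, h⟩ }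
    Literature.AnabelianGeometry.SemiGraphs.Cor311 p p Ω Ω :=
  cor311_of_certifies_injective_finite_nodesOnly p _ _ (fun _ _ h => h) (fun _ _ h => h)

/-! ### §6 Non-vacuity: the certified class is inhabited by carriers with genuine nodes -/

/-- **The class `𝒞` is inhabited over every `ℚ_p`, with NODES**: the split `p`-adic models over the Iwahori
witness graphs `𝒢₁(p)` (one vertex `ℤ_p ⋊ (1 + pℤ_p)`, one node; `Nat.card` of vertices `= 1`) and `𝒟₁(p)`
(two vertices, one node; `= 2`), each with a tempered chart (`ExistsTemperedPiChart_holds`), have injective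
admissible quotient and finite nodes-only special fibre — so the origins of §2–§5 certify something, and the
binder types of the instance forms are inhabited. [cite: MochizukiSemiAnbd2006, Ex 3.10 p.44] -/
theorem exists_certified_injectiveNodesOnly (p : ℕ) [Fact p.Prime] :
    (∃ (D : TemperedArithmeticGroup ℚ_[p]) (S : SpecialFibreData D),
      S.Gc = IwahoriWitness.loopGraph p ∧ Function.Injective S.admissible ∧ Finite S.Gc.graph.Vertex ∧
        Finite S.Gc.graph.Edge ∧ (∀ e, S.Gc.graph.IsClosedEdge e) ∧ Nonempty S.Gc.graph.Edge ∧
        Nat.card S.Gc.graph.Vertex = 1) ∧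
    ∃ (D : TemperedArithmeticGroup ℚ_[p]) (S : SpecialFibreData D),
      S.Gc = IwahoriWitness.doubleLoop p ∧ Function.Injective S.admissible ∧ Finite S.Gc.graph.Vertex ∧
        Finite S.Gc.graph.Edge ∧ (∀ e, S.Gc.graph.IsClosedEdge e) ∧ Nonempty S.Gc.graph.Edge ∧
        Nat.card S.Gc.graph.Vertex = 2 := by
  obtain ⟨c₁⟩ := ExistsTemperedPiChart_holds _ (IwahoriWitness.loopGraph_prop36Hypotheses p)
  obtain ⟨c₂⟩ := ExistsTemperedPiChart_holds _ (IwahoriWitness.doubleLoop_prop36Hypotheses p)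
  obtain ⟨D₁, S₁, h₁, hi₁⟩ := TemperedArithmeticGroup.exists_padic_specialFibreModel_injective p _
    (IwahoriWitness.loopGraph_thm37Hypotheses p) c₁
  obtain ⟨D₂, S₂, h₂, hi₂⟩ := TemperedArithmeticGroup.exists_padic_specialFibreModel_injective p _
    (IwahoriWitness.doubleLoop_thm37Hypotheses p) c₂
  refine ⟨⟨D₁, S₁, h₁, hi₁, ?_⟩, ⟨D₂, S₂, h₂, hi₂, ?_⟩⟩
  · rw [h₁]
    exact ⟨inferInstanceAs (Finite PUnit), inferInstanceAs (Finite (ULift (Fin 1))),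
      isClosedEdge_of_isGraph (IwahoriWitness.loopGraph_isGraph p), ⟨⟨0⟩⟩,
      by change Nat.card PUnit = 1; exact Nat.card_unique⟩
  · rw [h₂]
    exact ⟨inferInstanceAs (Finite (ULift Bool)), inferInstanceAs (Finite PUnit),
      isClosedEdge_of_isGraph (IwahoriWitness.doubleLoop_cor39Hypotheses p).isGraph, ⟨PUnit.unit⟩,
      by rw [Nat.card_eq_fintype_card]; rfl⟩

end Instances

end Literature.AnabelianGeometry.SemiGraphs

end
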